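import Summits.HubbardSuperconductivity.HubbardSuperconductivity.Theorems.AnisotropyChordTransferFibre3FinX5Green
import Summits.HubbardSuperconductivity.HubbardSuperconductivity.Theorems.AnisotropyChordTransferFibre3FinRCCell

/-!
# Route `AnisotropyChord` / H0 rotor rung: FIN per-`L` GM₃ (X5) — monotonicity of `a_λ(r)` and the cell tables from two point wedges

Soundness layer 2 of `…FinX5Eval`: ★ `aKer_mono` — `a_λ(r) = G̃_λ(0) − G̃_λ(r) = (1/V)Σ_{k≠0}(1 − cos k·r)/(2ε(k) − λ)` is nondecreasing in
`λ` below the pair spectrum (resolvent identity `Gres_sub_Gres`, nonnegative weights); ★ `mem_aIvA` — on a λ-cell `[la, lb]` with positive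
point denominators at both ends, `a_λ(r) ∈ aIvA` (lower end from the wedge at `la`, upper end from the wedge at `lb`); ★ `tabEnclA` — the
profile table `fTabA` encloses the explicit ground profile `groundF L λ`; ★ `gradEnclA` — the gradient table `gTabA` encloses
`D_{x̂}(groundF L λ)` at every site (core sites from the profile table, g4's `mem_dIv`; elsewhere `c_s·(a_λ(r) − a_λ(r − x̂))`).
Prover seat `hubbard-h0-rotor-p3` g8; helper for piece A = stmt-HubbardSuperconductivity-23918 of rung 19089 (`--supports`, helper
class).  WHAT THIS IS NOT: nothing here proves superconductivity in the Hubbard model (rotor TARGET as worded stays FALSE, g15 verdict);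
evaluator soundness for the FIN certificates of ONE conditional reduction.  Tree imports only; no sorry, no new axioms.
-/

set_option linter.dupNamespace false
set_option autoImplicit false

namespace Summit.HubbardSuperconductivity.HubbardSuperconductivity.Theorems.AnisotropyChord.Transfer.Fibre3

namespace FinCell

open scoped BigOperators
open Hole2 FinXB
open Finset hiding fold

variable {L : ℕ} [NeZero L]

/-! ## Monotonicity of the potential kernel in `λ` -/

/-- ★ `a_λ'(r) ≤ a_λ(r)` for `λ' ≤ λ` when every pair denominator is positive at `λ`. [folklore] -/
theorem aKer_mono {lam lam' : ℝ} (hle : lam' ≤ lam)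
    (hden : ∀ k1 k2 : ℕ, k1 < L → k2 < L → ¬ (k1 = 0 ∧ k2 = 0) → 0 < 2 * epsN L k1 k2 - lam)
    {r1 r2 : ℕ} (h1 : r1 < L) (h2 : r2 < L) :
    aKer L lam' ((((r1 : ℕ) : ZMod L)), (((r2 : ℕ) : ZMod L))) ≤ aKer L lam ((((r1 : ℕ) : ZMod L)), (((r2 : ℕ) : ZMod L))) := by
  have hL0 : 0 < L := by omega
  have hne : ∀ k1 k2 : ℕ, k1 < L → k2 < L → ¬ (k1 = 0 ∧ k2 = 0) →
      2 * epsN L k1 k2 - lam ≠ 0 ∧ 2 * epsN L k1 k2 - lam' ≠ 0 := fun k1 k2 hk1 hk2 hk =>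
    ⟨ne_of_gt (hden k1 k2 hk1 hk2 hk), ne_of_gt (by have := hden k1 k2 hk1 hk2 hk; linarith)⟩
  have e0 : ((((0 : ℕ) : ZMod L), (((0 : ℕ) : ZMod L))) : Tor L) = 0 := by ext <;> simp
  unfold aKer
  have d0 := Gres_sub_Gres L hne hL0 hL0
  have dr := Gres_sub_Gres L hne h1 h2
  rw [e0] at d0
  -- `slopeSum 0 0 − slopeSum r ≥ 0`
  have hsw : ∀ k1 k2 : ℕ, k1 < L → k2 < L → ¬ (k1 = 0 ∧ k2 = 0) → 0 ≤ sw L lam lam' k1 k2 := by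
    intro k1 k2 hk1 hk2 hk
    unfold sw
    have ha := hden k1 k2 hk1 hk2 hk
    have hb : 0 < 2 * epsN L k1 k2 - lam' := by linarith
    positivity
  have hterm : ∀ k1 ∈ range L, ∀ k2 ∈ range L,
      wterm L (sw L lam lam') r1 r2 k1 k2 ≤ wterm L (sw L lam lam') 0 0 k1 k2 := by
    intro k1 hk1 k2 hk2
    rw [Finset.mem_range] at hk1 hk2
    unfold wterm
    by_cases hk : k1 = 0 ∧ k2 = 0
    · rw [if_pos hk, if_pos hk]
    · rw [if_neg hk, if_neg hk]
      have hs := hsw k1 k2 hk1 hk2 hk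
      have hc := Real.cos_le_one (2 * Real.pi * (((k1 * r1 + k2 * r2) % L : ℕ) : ℝ) / L)
      have e : (((k1 * 0 + k2 * 0) % L : ℕ) : ℝ) = 0 := by simp
      rw [e, mul_zero, zero_div, Real.cos_zero, one_mul]
      nlinarith
  have hS : slopeSum L lam lam' r1 r2 ≤ slopeSum L lam lam' 0 0 := by
    unfold slopeSum
    have hLpos : (0 : ℝ) < (L : ℝ) ^ 2 := by
      have : (0 : ℝ) < L := by exact_mod_cast hL0
      positivity
    exact div_le_div_of_nonneg_right (Finset.sum_le_sum fun k1 hk1 => Finset.sum_le_sum fun k2 hk2 => hterm k1 hk1 k2 hk2) hLpos.le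
  have hl : 0 ≤ lam - lam' := by linarith
  nlinarith [d0, dr, hS, hl]

omit [NeZero L] in
/-- positive point denominators `⇒` positive pair denominators at the point. [folklore] -/
theorem den_pos_pt (hL : 3 ≤ L) {lam : ℤ} (hpos : denCellPos L (cosTab L) lam lam = true)
    {k1 k2 : ℕ} (hk1 : k1 < L) (hk2 : k2 < L) (hk : ¬ (k1 = 0 ∧ k2 = 0)) :
    0 < 2 * epsN L k1 k2 - (lam : ℝ) / ((D : ℤ) : ℝ) := by
  have hD := D_pos
  refine den_ne_zero_of_cell L hL (lam := (lam : ℝ) / ((D : ℤ) : ℝ)) ?_ ?_ hpos hk1 hk2 hk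
  · rw [div_mul_cancel₀ _ (ne_of_gt hD)]
  · rw [div_mul_cancel₀ _ (ne_of_gt hD)]

/-! ## The potential-kernel enclosure on the cell -/

/-- ★ `a_λ(r) ∈ aIvA` for `λ·D ∈ [la, lb]` (monotonicity between the two point wedges). [folklore] -/
theorem mem_aIvA (hL : 3 ≤ L) {lam : ℝ} {la lb : ℤ}
    (hla : (la : ℝ) ≤ lam * ((D : ℤ) : ℝ)) (hlb : lam * ((D : ℤ) : ℝ) ≤ (lb : ℝ))
    (hposa : denCellPos L (cosTab L) la la = true) (hposb : denCellPos L (cosTab L) lb lb = true)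
    {r1 r2 : ℕ} (h1 : r1 < L) (h2 : r2 < L) :
    mem (aKer L lam ((((r1 : ℕ) : ZMod L)), (((r2 : ℕ) : ZMod L))))
      (aIvA L la lb (gWedgePt L la) (gWedgePt L lb) r1 r2) := by
  have hD := D_pos
  have hL0 : 0 < L := by omega
  set la0 : ℝ := (la : ℝ) / ((D : ℤ) : ℝ) with hla0
  set lb0 : ℝ := (lb : ℝ) / ((D : ℤ) : ℝ) with hlb0
  have ha1 : (la : ℝ) ≤ la0 * ((D : ℤ) : ℝ) := by rw [hla0, div_mul_cancel₀ _ (ne_of_gt hD)]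
  have ha2 : la0 * ((D : ℤ) : ℝ) ≤ (la : ℝ) := by rw [hla0, div_mul_cancel₀ _ (ne_of_gt hD)]
  have hb1 : (lb : ℝ) ≤ lb0 * ((D : ℤ) : ℝ) := by rw [hlb0, div_mul_cancel₀ _ (ne_of_gt hD)]
  have hb2 : lb0 * ((D : ℤ) : ℝ) ≤ (lb : ℝ) := by rw [hlb0, div_mul_cancel₀ _ (ne_of_gt hD)]
  have hle1 : la0 ≤ lam := by rw [hla0, div_le_iff₀ hD]; exact hla
  have hle2 : lam ≤ lb0 := by rw [hlb0, le_div_iff₀ hD]; exact hlb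
  have hdenb := fun k1 k2 (hk1 : k1 < L) (hk2 : k2 < L) hk => den_pos_pt hL hposb hk1 hk2 hk
  have hdenm : ∀ k1 k2 : ℕ, k1 < L → k2 < L → ¬ (k1 = 0 ∧ k2 = 0) → 0 < 2 * epsN L k1 k2 - lam :=
    fun k1 k2 hk1 hk2 hk => by have := hdenb k1 k2 hk1 hk2 hk; linarith
  have m1 := aKer_mono hle1 hdenm h1 h2
  have m2 := aKer_mono hle2 hdenb h1 h2
  have e0 : ((((0 : ℕ) : ZMod L), (((0 : ℕ) : ZMod L))) : Tor L) = 0 := by ext <;> simp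
  have g0a := mem_G0_cell (L := L) hL ha1 ha2 hposa
  have g0b := mem_G0_cell (L := L) hL hb1 hb2 hposb
  have gra := mem_gW hL ha1 ha2 hposa h1 h2
  have grb := mem_gW hL hb1 hb2 hposb h1 h2
  unfold aIvA
  unfold aKer at m1 m2 ⊢
  constructor
  · have h := m1
    obtain ⟨l1, -⟩ := g0a
    obtain ⟨-, u1⟩ := gra
    push_cast
    nlinarith [hD]
  · obtain ⟨-, u2⟩ := g0b
    obtain ⟨l2, -⟩ := grb
    push_cast
    nlinarith [hD]

/-! ## The profile table -/

/-- ★ THE X5 PROFILE TABLE ENCLOSES THE EXPLICIT GROUND PROFILE on the cell. [folklore] -/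
theorem tabEnclA (hL : 3 ≤ L) {lam : ℝ} (hlam : 0 < lam) {la lb : ℤ}
    (hla : (la : ℝ) ≤ lam * ((D : ℤ) : ℝ)) (hlb : lam * ((D : ℤ) : ℝ) ≤ (lb : ℝ))
    (hchk : groundCellCheck L la lb = true)
    (hposa : denCellPos L (cosTab L) la la = true) (hposb : denCellPos L (cosTab L) lb lb = true) :
    TabEncl L (groundF L lam) (fTabA L la lb (gWedgePt L la) (gWedgePt L lb)) := by
  intro r1 r2 h1 h2
  unfold fTabA
  rw [getF_mkTab _ h1 h2]
  by_cases hr : r1 = 0 ∧ r2 = 0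
  · rw [if_pos hr]
    obtain ⟨e1, e2⟩ := hr
    subst e1; subst e2
    have e : ((((0 : ℕ) : ZMod L), (((0 : ℕ) : ZMod L))) : Tor L) = 0 := by ext <;> simp
    rw [e]
    unfold groundF
    rw [if_pos rfl]
    have := mem_exact 0
    push_cast at this
    rw [zero_div] at this
    exact this
  · rw [if_neg hr]
    have hne : ((((r1 : ℕ) : ZMod L), (((r2 : ℕ) : ZMod L))) : Tor L) ≠ 0 := by
      rw [Ne, Prod.mk_eq_zero, natCast_zmod_eq_zero L h1, natCast_zmod_eq_zero L h2]
      exact hr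
    unfold groundF
    rw [if_neg hne]
    exact mem_iadd (mem_deltaMulFnn_cell L hL hlam hla hlb hchk)
      (mem_imul (mem_groundCs_cell L hL hlam hla hlb hchk) (mem_aIvA hL hla hlb hposa hposb h1 h2))

/-! ## The gradient table -/

/-- ★ THE X5 GRADIENT TABLE ENCLOSES `D_{x̂}` OF THE GROUND PROFILE at every site. [folklore] -/
theorem gradEnclA (hL : 3 ≤ L) {lam : ℝ} (hlam : 0 < lam) {la lb : ℤ}
    (hla : (la : ℝ) ≤ lam * ((D : ℤ) : ℝ)) (hlb : lam * ((D : ℤ) : ℝ) ≤ (lb : ℝ))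
    (hchk : groundCellCheck L la lb = true)
    (hposa : denCellPos L (cosTab L) la la = true) (hposb : denCellPos L (cosTab L) lb lb = true)
    {r1 r2 : ℕ} (hr1 : r1 < L) (hr2 : r2 < L) :
    mem (Dgrad L (groundF L lam) ((((1 : ℕ) : ZMod L)), (((0 : ℕ) : ZMod L)))
          ((((r1 : ℕ) : ZMod L)), (((r2 : ℕ) : ZMod L))))
      (getF (gTabA L la lb (gWedgePt L la) (gWedgePt L lb) (fTabA L la lb (gWedgePt L la) (gWedgePt L lb))) r1 r2) := by
  have hL0 : 0 < L := by omega
  have h1L : 1 < L := by omega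
  have hft := tabEnclA hL hlam hla hlb hchk hposa hposb
  unfold gTabA
  rw [getF_mkTab _ hr1 hr2]
  by_cases hc : (r1 = 0 ∧ r2 = 0) ∨ (subm L r1 1 = 0 ∧ subm L r2 0 = 0)
  · rw [if_pos hc]
    exact mem_dIv hft h1L hL0 hr1 hr2
  · rw [if_neg hc]
    push Not at hc
    obtain ⟨hc1, hc2⟩ := hc
    have hs1 := subm_lt L r1 1 hL0
    have hs2 := subm_lt L r2 0 hL0
    have hr : ((((r1 : ℕ) : ZMod L), (((r2 : ℕ) : ZMod L))) : Tor L) ≠ 0 := by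
      rw [Ne, Prod.mk_eq_zero, natCast_zmod_eq_zero L hr1, natCast_zmod_eq_zero L hr2]
      exact fun h => hc1 h.1 h.2
    have hs : ((((subm L r1 1 : ℕ) : ZMod L), (((subm L r2 0 : ℕ) : ZMod L))) : Tor L) ≠ 0 := by
      rw [Ne, Prod.mk_eq_zero, natCast_zmod_eq_zero L hs1, natCast_zmod_eq_zero L hs2]
      exact fun h => hc2 h.1 h.2
    unfold Dgrad
    rw [pt_sub 1 0 r1 r2 h1L hL0, groundF_sub lam hr hs]
    have hsub0 : subm L r2 0 = r2 := by
      unfold subm; rw [Nat.sub_zero, Nat.add_mod_right, Nat.mod_eq_of_lt hr2]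
    rw [hsub0]
    have ma := mem_aIvA hL hla hlb hposa hposb hr1 hr2
    have mb := mem_aIvA hL hla hlb hposa hposb hs1 hr2
    have e : -(groundCs L lam * (Gres L lam ((((r1 : ℕ) : ZMod L)), (((r2 : ℕ) : ZMod L)))
          - Gres L lam ((((subm L r1 1 : ℕ) : ZMod L)), (((r2 : ℕ) : ZMod L)))))
        = groundCs L lam * (aKer L lam ((((r1 : ℕ) : ZMod L)), (((r2 : ℕ) : ZMod L)))
          - aKer L lam ((((subm L r1 1 : ℕ) : ZMod L)), (((r2 : ℕ) : ZMod L)))) := by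
      unfold aKer; ring
    rw [e]
    exact mem_imul (mem_groundCs_cell L hL hlam hla hlb hchk) (mem_isub ma mb)

end FinCell

end Summit.HubbardSuperconductivity.HubbardSuperconductivity.Theorems.AnisotropyChord.Transfer.Fibre3
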